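import Literature.MathematicalPhysics.QuantumFieldTheory.ConformalBootstrap3D.PointKernelK34v2Data
import Literature.MathematicalPhysics.QuantumFieldTheory.ConformalBootstrap3D.PointKernelParts

/-!
# K34v2 certificate, kernel part file P36: one-cell head segments 148 in level ranges

The head cells whose kernel evaluation exceeds one `decide` are one-cell segments of `hsegsK34v2`; each is
checked by `PCert.hPartSideOK` (side conditions) and `PCert.hPartOK` per level range `[n_lo, n_lo + count)`
against an integer claim, the claims summing to `≥ 0` (`PointKernel.partsOK`); soundness is
`PCert.hParts_sound` (`PointKernelParts`).  The part files `P1, P2, …` are mutually independent (each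
imports only the data file); the ranges of one cell may span several of them, and the per-cell
conclusions `hparts_i` / `hcell_i` of those cells are assembled in `PointKernelK34v2.lean`.
Estimated kernel time 236 s.
-/

set_option maxRecDepth 100000
set_option maxHeartbeats 0

namespace Literature.MathematicalPhysics.QuantumFieldTheory.ConformalBootstrap3D.PointKernelK34v2

open Literature.MathematicalPhysics.QuantumFieldTheory.ConformalBootstrap3D.PointKernel

/-- levels `[0, 28)` of segment 148: partial lower sum `≥` claim. [folklore] -/
theorem part_148_0 : certK34v2.hPartOK (PCert.segAt hsegsK34v2 148) JHK34v2 0 28 (-33598468907016926231571001203081531312) = true := by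
  decide +kernel

/-- levels `[28, 40)` of segment 148: partial lower sum `≥` claim. [folklore] -/
theorem part_148_1 : certK34v2.hPartOK (PCert.segAt hsegsK34v2 148) JHK34v2 28 12 (23719637812507373025846123359770950329) = true := by
  decide +kernel

/-- levels `[40, 49)` of segment 148: partial lower sum `≥` claim. [folklore] -/
theorem part_148_2 : certK34v2.hPartOK (PCert.segAt hsegsK34v2 148) JHK34v2 40 9 (6592249397179226484666436380022646956) = true := by
  decide +kernel

/-- levels `[49, 56)` of segment 148: partial lower sum `≥` claim. [folklore] -/
theorem part_148_3 : certK34v2.hPartOK (PCert.segAt hsegsK34v2 148) JHK34v2 49 7 (2141614782159830354983968806653245514) = true := by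
  decide +kernel

end Literature.MathematicalPhysics.QuantumFieldTheory.ConformalBootstrap3D.PointKernelK34v2
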